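import Mathlib.RepresentationTheory.Coinduced
import Mathlib.GroupTheory.IndexNormal
import Mathlib.Tactic.Group
import Mathlib.Tactic.LinearCombination
import HarnessLib

/-!
# Route `SignedLowerHalves`, crux L `SmallImageLowerHalfBothSigns` (item stmt-BirchSwinnertonDyer-23599), line `rtt_w3` v5 —
# brick B3 of the road of record for the engine stub PSB_T3 (card `shapiro`, step E1b): a representation whose restriction to an
# index-`2` subgroup `U` has a `U`-eigenline `k·v` with `(v, g₀v)` a basis IS the coinduced representation `Coind_U^G χ`

LEAD `cruxlead-stmt-BirchSwinnertonDyer-23599` g3 (cell `bsd-ssimc`); ROUTE-INDEPENDENT helper (`--supports stmt-BirchSwinnertonDyer-23599`); pure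
algebra over Mathlib's `Representation.coind`; THEOREMS ONLY (the isomorphism is delivered as an `∃` with its characterising formula);
no named fact, no `sorry`; closes nothing; BSD is not proved by any of this.

WHY (card `Ideas/shapiro.md` (b3), LEAD census `Lines/rtt_w3-CENSUS-PSB-g3.md` §2 E1): on the small-image class X7 the image of `ρ̄_{W,p}`
normalises a non-split Cartan subgroup `kˣ ⊂ GL₂(𝔽_p)` and `U := ρ̄⁻¹(kˣ) ≤ Γ_ℚ` is the open index-`2` subgroup cutting out the imaginary
quadratic shadow field `K` (tree: `smallImage_exists_frame_shadow_inert`, `…KobayashiMainConjectureSmallImageShadowInert`). After extending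
scalars to `k ⊇ 𝔽_{p²}`, `U` acts on an eigenvector `v` through a character `χ = ψ̄` and `(v, ρ̄(g₀)v)` is a basis for any `g₀ ∉ U`
(`ψ̄ ≠ ψ̄^p` on inertia at `p`: level-`2` fundamental characters). This file supplies the abstract step: such a representation is
`Coind_U^G χ` — with an EXPLICIT intertwiner, Frobenius reciprocity's `w ↦ (x ↦ α(ρ(x)w))` for the `χ`-eigenfunctional `α = v^*` — so that
`Hⁿ(ℚ_n, ρ̄ ⊗ k) ≅ Hⁿ(ℚ_n, Coind_U^G ψ̄)`, to which brick B2 (`…RttShapiroMackey`, Shapiro∘Mackey) applies.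

* `eigenfunctional_of_index_two` — the dual vector `α = v^*` is a `χ`-eigenfunctional: `α(ρ(u)w) = χ(u)·α(w)` (`U` is normal, `g₀⁻¹ug₀ ∈ U`).
* ★ `exists_equiv_coind_of_index_two` — `∃ e : ρ ≃ Coind_U^G χ` (a `Representation.Equiv`) with `(e w)(x) = α(ρ(x) w)`.

References: textbook (Serre, Linear Representations of Finite Groups §7.2; Brown, Cohomology of Groups III.5) [folklore]; motivation
[Serre1972] §2.2 Prop. 14, §4.2 c); [Rubin1991] §4.
-/

set_option autoImplicit false
-- D-0017: single-problem summit, the namespace repeats the problem name by design.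
set_option linter.dupNamespace false
noncomputable section

open Representation

universe u

namespace Summit.BirchSwinnertonDyer.BirchSwinnertonDyer.Theorems.SmallImageRttShapiro

variable {k G : Type u} [CommRing k] [Group G] (U : Subgroup G)
  {V : Type u} [AddCommGroup V] [Module k V] (ρ : Representation k G V)

/-- **The dual vector of a `U`-eigenvector is a `χ`-eigenfunctional** when `[G : U] = 2`: if `ρ(u)v = χ(u)v` for `u ∈ U`, `g₀ ∉ U`,
and `α, β` are coordinates for the spanning pair `(v, ρ(g₀)v)` with `α(v) = 1`, `α(ρ(g₀)v) = 0`, then `α(ρ(u)w) = χ(u)·α(w)` for all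
`u ∈ U`, `w ∈ V` — because `U` is normal (index `2`), so `ρ(u)ρ(g₀)v = χ(g₀⁻¹ug₀)·ρ(g₀)v` stays in `ker α`. [folklore] -/
theorem eigenfunctional_of_index_two (hU : U.index = 2) (g₀ : G) (χ : U →* kˣ) (v : V)
    (hv : ∀ u : U, ρ (u : G) v = ((χ u : kˣ) : k) • v) (α β : V →ₗ[k] k)
    (hdec : ∀ w : V, α w • v + β w • ρ g₀ v = w) (hαv : α v = 1) (hαg : α (ρ g₀ v) = 0)
    (u : U) (w : V) : α (ρ (u : G) w) = ((χ u : kˣ) : k) * α w := by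
  haveI : U.Normal := Subgroup.normal_of_index_eq_two hU
  -- `g₀⁻¹ u g₀ ∈ U`
  have hconj : g₀⁻¹ * (u : G) * g₀ ∈ U := by
    have := Subgroup.Normal.conj_mem inferInstance (u : G) u.2 g₀⁻¹
    simpa [mul_assoc] using this
  have hug : ρ (u : G) (ρ g₀ v) = ((χ ⟨g₀⁻¹ * (u : G) * g₀, hconj⟩ : kˣ) : k) • ρ g₀ v := by
    have h1 : ρ (u : G) (ρ g₀ v) = ρ g₀ (ρ (g₀⁻¹ * (u : G) * g₀) v) := by
      rw [← Module.End.mul_apply, ← map_mul, ← Module.End.mul_apply, ← map_mul]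
      congr 1; group
    have h2 : ρ (g₀⁻¹ * (u : G) * g₀) v = ((χ ⟨g₀⁻¹ * (u : G) * g₀, hconj⟩ : kˣ) : k) • v :=
      hv ⟨g₀⁻¹ * (u : G) * g₀, hconj⟩
    rw [h1, h2, map_smul]
  calc α (ρ (u : G) w) = α (ρ (u : G) (α w • v + β w • ρ g₀ v)) := by rw [hdec w]
    _ = α w * α (ρ (u : G) v) + β w * α (ρ (u : G) (ρ g₀ v)) := by
        simp only [map_add, map_smul, smul_eq_mul]
    _ = ((χ u : kˣ) : k) * α w := by
        rw [hv u, hug, map_smul, map_smul, hαv, hαg, smul_eq_mul, smul_eq_mul]; ring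

/-- ★ **A representation with an index-`2` eigenline is coinduced.** Let `[G : U] = 2`, `g₀ ∉ U`, `χ : U → kˣ`, `v ∈ V` with `ρ(u)v = χ(u)v`
(`u ∈ U`), and suppose `(v, ρ(g₀)v)` spans `V` with coordinate functionals `α, β` (`w = α(w)v + β(w)ρ(g₀)v`, `α(v) = 1`, `α(ρ(g₀)v) = 0`).
Then `ρ ≃ Coind_U^G χ` (`χ` as the one-dimensional representation `u ↦ (χ(u)·)` on `k`) by the Frobenius-reciprocity intertwiner
`e(w) = (x ↦ α(ρ(x)w))`: injective since `(e w)(1) = α(w)` and `(e w)(g₀) = χ(g₀²)β(w)`; surjective since a `U`-equivariant function on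
`G = U ⊔ Ug₀` is determined by its values at `1` and `g₀`. On the crux: `ρ = ρ̄_{W,p} ⊗ k`, `U = Gal(·/K)`, `χ = ψ̄`. [folklore] -/
theorem exists_equiv_coind_of_index_two (hU : U.index = 2) (g₀ : G) (hg₀ : g₀ ∉ U) (χ : U →* kˣ) (v : V)
    (hv : ∀ u : U, ρ (u : G) v = ((χ u : kˣ) : k) • v) (α β : V →ₗ[k] k)
    (hdec : ∀ w : V, α w • v + β w • ρ g₀ v = w) (hαv : α v = 1) (hαg : α (ρ g₀ v) = 0) :
    ∃ e : Representation.Equiv ρ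
        (coind U.subtype ((DistribMulAction.toModuleEnd k k).comp ((Units.coeHom k).comp χ))),
      ∀ (w : V) (x : G), (e.toLinearEquiv w).1 x = α (ρ x w) := by
  classical
  set ψ : Representation k U k := (DistribMulAction.toModuleEnd k k).comp ((Units.coeHom k).comp χ) with hψ
  have hψapp : ∀ (u : U) (y : k), ψ u y = ((χ u : kˣ) : k) * y := by
    intro u y
    simp [hψ, DistribSMul.toLinearMap_apply, smul_eq_mul]
  have hα : ∀ (u : U) (w : V), α (ρ (u : G) w) = ((χ u : kˣ) : k) * α w :=
    eigenfunctional_of_index_two U ρ hU g₀ χ v hv α β hdec hαv hαg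
  -- `g₀² ∈ U` and the value of `ρ(g₀)ρ(g₀)v`
  have hg2 : g₀ * g₀ ∈ U := (Subgroup.mul_mem_iff_of_index_two hU).mpr Iff.rfl
  have hρg2 : ρ g₀ (ρ g₀ v) = ((χ ⟨g₀ * g₀, hg2⟩ : kˣ) : k) • v := by
    rw [← Module.End.mul_apply, ← map_mul]
    exact hv ⟨g₀ * g₀, hg2⟩
  -- the intertwiner
  let Φ : V →ₗ[k] coindV U.subtype ψ :=
    { toFun := fun w ↦ ⟨fun x ↦ α (ρ x w), fun u x ↦ by
        simp only [hψapp, Subgroup.coe_subtype, map_mul, Module.End.mul_apply, hα]⟩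
      map_add' := fun w₁ w₂ ↦ by ext x; simp
      map_smul' := fun c w ↦ by ext x; simp }
  have Φ_apply : ∀ (w : V) (x : G), (Φ w).1 x = α (ρ x w) := fun _ _ ↦ rfl
  have Φ_one : ∀ w : V, (Φ w).1 1 = α w := fun w ↦ by rw [Φ_apply, map_one, Module.End.one_apply]
  have Φ_g₀ : ∀ w : V, (Φ w).1 g₀ = ((χ ⟨g₀ * g₀, hg2⟩ : kˣ) : k) * β w := fun w ↦ by
    rw [Φ_apply]
    conv_lhs => rw [← hdec w]
    simp only [map_add, map_smul, hρg2, hαg, hαv, smul_eq_mul, mul_zero, zero_add, mul_one]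
    ring
  -- a `U`-equivariant function is determined by its values at `1` and `g₀`
  have det : ∀ f g : coindV U.subtype ψ, f.1 1 = g.1 1 → f.1 g₀ = g.1 g₀ → f = g := by
    intro f g h1 h2
    apply Subtype.ext
    funext x
    by_cases hx : x ∈ U
    · have hf := f.2 ⟨x, hx⟩ 1
      have hg := g.2 ⟨x, hx⟩ 1
      simp only [Subgroup.coe_subtype, mul_one] at hf hg
      rw [hf, hg, h1]
    · have hxg : x * g₀⁻¹ ∈ U := by
        rw [Subgroup.mul_mem_iff_of_index_two hU]
        exact ⟨fun h ↦ absurd h hx, fun h ↦ absurd (by simpa using h) hg₀⟩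
      have hf := f.2 ⟨x * g₀⁻¹, hxg⟩ g₀
      have hg := g.2 ⟨x * g₀⁻¹, hxg⟩ g₀
      simp only [Subgroup.coe_subtype, inv_mul_cancel_right] at hf hg
      rw [hf, hg, h2]
  have inj : Function.Injective Φ := by
    intro w₁ w₂ h
    have h1 : α w₁ = α w₂ := by rw [← Φ_one, ← Φ_one, h]
    have h2 : β w₁ = β w₂ := by
      have := congrArg (fun f : coindV U.subtype ψ ↦ f.1 g₀) h
      simp only [Φ_g₀] at this
      exact_mod_cast (Units.mul_right_inj _).mp this
    rw [← hdec w₁, ← hdec w₂, h1, h2]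
  have surj : Function.Surjective Φ := by
    intro f
    have hc : (((χ ⟨g₀ * g₀, hg2⟩)⁻¹ : kˣ) : k) * ((χ ⟨g₀ * g₀, hg2⟩ : kˣ) : k) = 1 := Units.inv_mul _
    refine ⟨f.1 1 • v + (((χ ⟨g₀ * g₀, hg2⟩)⁻¹ : kˣ) : k) • f.1 g₀ • ρ g₀ v, det _ _ ?_ ?_⟩
    · rw [Φ_one]
      simp only [map_add, map_smul, hαv, hαg, smul_eq_mul, mul_one, mul_zero, add_zero]
    · rw [Φ_apply]
      simp only [map_add, map_smul, hρg2, hαv, hαg, smul_eq_mul, mul_one, mul_zero, zero_add]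
      linear_combination (f.1 g₀) * hc
  refine ⟨Representation.Equiv.mk (LinearEquiv.ofBijective Φ ⟨inj, surj⟩) fun g ↦ ?_, fun w x ↦ rfl⟩
  apply LinearMap.ext
  intro w
  apply Subtype.ext
  funext x
  change α (ρ x (ρ g w)) = α (ρ (x * g) w)
  rw [map_mul, Module.End.mul_apply]

end Summit.BirchSwinnertonDyer.BirchSwinnertonDyer.Theorems.SmallImageRttShapiro

end
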